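import Summits.KontsevichZagierPeriods.KontsevichZagierPeriods.Theorems.HurwitzMicroSectorsHurwitzSectorComplementStubTowerReductionSlab
import Summits.KontsevichZagierPeriods.KontsevichZagierPeriods.Theorems.HurwitzMicroSectorsHurwitzSectorComplementStubTowerReductionKernelPoly

/-!
# `HurwitzSectorComplement` (stmt-KontsevichZagierPeriods-14341, route HurwitzMicroSectors),
# line `chebyshev-level-deformation`: the twisted parity tower from the parity tower sector

`stub_towerReduction` of the gen-1 skeleton — Conjecture 1 of Kontsevich–Zagier for every pair of
TWISTED Bernoulli-parity cyclotomic kernel representations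
`[(0,1)^{k+2} × (0,α), K_{c₀}(x₁⋯x_{k+2})]` (`K = T_{c₀}` for even `k`, `U_{c₀}` for odd `k`;
`c₀ = cos(2πa/N)`, `0 ≤ 2a ≤ N`; `α > 0` real algebraic), across weights — is `TwistedParityTower` of
the crux ideation (SketchIdeator2 §2) sharpened to cyclotomic `c₀` as the triage demanded. Here it is
reduced to the line's sector theorem `parityTowerSector` (parallel lead c1; enters as the hypothesis
`hPTS`, verbatim): de-twist by one rule-(3) move along the last coordinate (`towerReduction_slab`:
`[box × (0,α), K] ~ [box, αK]`), rewrite the cyclotomic kernel as a real-algebraic (anti)symmetric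
numerator over `1 − t^N` (`towerReduction_kernelPoly`: finite geometric series at the root of unity
`e^{2πia/N}`), and apply the sector theorem to the two de-twisted box representations (soundness
transports the values). Reference: M. Kontsevich, D. Zagier, *Periods* (2001), §1.2.
-/

noncomputable section

open Set MeasureTheory Polynomial
open scoped BigOperators
open Literature.NumberTheory.Transcendental

namespace Summit.KontsevichZagierPeriods.Theorems.HurwitzMicroSectorsHurwitzSectorComplement

namespace TowerReduction

/-- **De-twisting into the sector.** A twisted cyclotomic kernel representation of box dimension
`k+2` is KZ-equivalent to a box representation of the shape `[(0,1)^{k+2}, R(t)/(1 − t^N)]` with `R`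
real-algebraic, `(−1)^{k+2}`-symmetric, of degree `< N` (and `R_{N−1} = 0` when `k+2` is odd).
[cite: KontsevichZagier2001, §1.2 rules (1)–(3)] -/
theorem detwist (k N a : ℕ) (α : ℝ) (hN : 0 < N) (ha : 2 * a ≤ N) (hα : IsAlgebraic ℚ α) (hα0 : 0 < α)
    (r : KZ.IntegralRep (k + 3))
    (hrd : r.domain = {z | (∀ i : Fin (k + 2), z (Fin.castSucc i) ∈ Set.Ioo (0:ℝ) 1) ∧
      z (Fin.last (k + 2)) ∈ Set.Ioo 0 α})
    (hrf : Set.EqOn r.integrand (fun z => if Even k then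
        (Real.cos (2 * Real.pi * a / N) - ∏ i : Fin (k + 2), z (Fin.castSucc i)) /
          (1 - 2 * Real.cos (2 * Real.pi * a / N) * (∏ i : Fin (k + 2), z (Fin.castSucc i)) +
            (∏ i : Fin (k + 2), z (Fin.castSucc i)) ^ 2)
        else Real.sqrt (1 - Real.cos (2 * Real.pi * a / N) ^ 2) /
          (1 - 2 * Real.cos (2 * Real.pi * a / N) * (∏ i : Fin (k + 2), z (Fin.castSucc i)) +
            (∏ i : Fin (k + 2), z (Fin.castSucc i)) ^ 2)) r.domain) :
    ∃ (r₀ : KZ.IntegralRep (k + 2)),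
      (∃ (Q R : Polynomial ℝ), (∀ i, IsAlgebraic ℚ (Q.coeff i)) ∧ (∀ i, IsAlgebraic ℚ (R.coeff i)) ∧
        R.natDegree < N ∧ (∀ i j : ℕ, i + j + 2 = N → R.coeff i = (-1 : ℝ) ^ (k + 2) * R.coeff j) ∧
        (Odd (k + 2) → R.coeff (N - 1) = 0) ∧ r₀.domain = {x | ∀ i, x i ∈ Set.Ioo (0:ℝ) 1} ∧
        Set.EqOn r₀.integrand (fun x => Polynomial.eval (∏ i, x i) Q +
          Polynomial.eval (∏ i, x i) R / (1 - (∏ i, x i) ^ N)) r₀.domain) ∧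
      KZ.Equivalent r r₀ := by
  obtain ⟨⟨RT, hRTa, hRTd, hRTs, hRTe⟩, ⟨RU, hRUa, hRUd, hRUs, hRU0, hRUe⟩, hker⟩ :=
    towerReduction_kernelPoly N a α hN ha hα
  obtain ⟨hsaT, hintT, hsaU, hintU⟩ := hker k
  set c₀ : ℝ := Real.cos (2 * Real.pi * a / N) with hc₀
  -- the base integrand
  set K : (Fin (k + 2) → ℝ) → ℝ := fun x => if Even k then
      (c₀ - ∏ i, x i) / (1 - 2 * c₀ * (∏ i, x i) + (∏ i, x i) ^ 2)
    else Real.sqrt (1 - c₀ ^ 2) / (1 - 2 * c₀ * (∏ i, x i) + (∏ i, x i) ^ 2) with hK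
  have hKsa : IsSemialgebraicFunOn ℚ {x : Fin (k + 2) → ℝ | ∀ i, x i ∈ Set.Ioo (0:ℝ) 1} K := by
    by_cases hk : Even k
    · simp only [hK, if_pos hk]; exact hsaT
    · simp only [hK, if_neg hk]; exact hsaU
  have hKint : IntegrableOn K {x : Fin (k + 2) → ℝ | ∀ i, x i ∈ Set.Ioo (0:ℝ) 1} := by
    by_cases hk : Even k
    · simp only [hK, if_pos hk]; exact hintT
    · simp only [hK, if_neg hk]; exact hintU
  have hrf' : Set.EqOn r.integrand (fun z => K (fun i => z (Fin.castSucc i))) r.domain := by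
    intro z hz
    rw [hrf hz]
  obtain ⟨r₀, hr₀d, hr₀f, hrr₀⟩ := towerReduction_slab k α K hα hα0 hKsa hKint r hrd hrf'
  have hbox : ∀ x : Fin (k + 2) → ℝ, x ∈ {x : Fin (k + 2) → ℝ | ∀ i, x i ∈ Set.Ioo (0:ℝ) 1} →
      0 ≤ ∏ i, x i ∧ ∏ i, x i < 1 := by
    intro x hx
    refine ⟨Finset.prod_nonneg fun i _ => (hx i).1.le, ?_⟩
    calc ∏ i, x i < ∏ _i : Fin (k + 2), (1:ℝ) :=
          Finset.prod_lt_prod_of_nonempty (fun i _ => (hx i).1) (fun i _ => (hx i).2)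
            Finset.univ_nonempty
      _ = 1 := by simp
  refine ⟨r₀, ?_, hrr₀⟩
  by_cases hk : Even k
  · refine ⟨0, RT, fun i => by rw [Polynomial.coeff_zero]; exact isAlgebraic_zero, hRTa, hRTd, fun i j hij => ?_, fun hodd => ?_, hr₀d, ?_⟩
    · have he : Even (k + 2) := hk.add (by decide)
      rw [he.neg_one_pow, one_mul]
      exact hRTs i j hij
    · exact absurd hodd (Nat.not_odd_iff_even.mpr (hk.add (by decide)))
    · intro x hx
      rw [hr₀f hx]
      rw [hr₀d] at hx
      obtain ⟨h0, h1⟩ := hbox x hx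
      simp only [hK, if_pos hk, Polynomial.eval_zero, zero_add]
      exact hRTe _ h0 h1
  · have hko : Odd k := Nat.not_even_iff_odd.mp hk
    refine ⟨0, RU, fun i => by rw [Polynomial.coeff_zero]; exact isAlgebraic_zero, hRUa, hRUd, fun i j hij => ?_, fun _ => hRU0, hr₀d, ?_⟩
    · have ho : Odd (k + 2) := hko.add_even (by decide)
      rw [ho.neg_one_pow, neg_one_mul]
      exact hRUs i j hij
    · intro x hx
      rw [hr₀f hx]
      rw [hr₀d] at hx
      obtain ⟨h0, h1⟩ := hbox x hx
      simp only [hK, if_neg hk, Polynomial.eval_zero, zero_add]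
      exact hRUe _ h0 h1

end TowerReduction

open TowerReduction in
/-- **The twisted parity tower from the parity tower sector** (`stub_towerReduction` of the gen-1
skeleton, modulo the line's sector theorem `parityTowerSector`, which enters as the hypothesis `hPTS`
verbatim): any two twisted Bernoulli-parity cyclotomic kernel representations
`[(0,1)^{k+2} × (0,α), K_{cos(2πa/N)}(x₁⋯x_{k+2})]` with equal values are KZ-equivalent.
[cite: KontsevichZagier2001, §1.2 Conjecture 1] -/
theorem stub_towerReduction_of_parityTowerSector : (∀ (w N w' N' : ℕ), 2 ≤ w → 1 ≤ N → 2 ≤ w' → 1 ≤ N' → ∀ (r : KZ.IntegralRep w) (r' : KZ.IntegralRep w'), (∃ (Q R : Polynomial ℝ), (∀ i, IsAlgebraic ℚ (Q.coeff i)) ∧ (∀ i, IsAlgebraic ℚ (R.coeff i)) ∧ R.natDegree < N ∧ (∀ i j : ℕ, i + j + 2 = N → R.coeff i = (-1 : ℝ) ^ w * R.coeff j) ∧ (Odd w → R.coeff (N - 1) = 0) ∧ r.domain = {x | ∀ i, x i ∈ Set.Ioo (0:ℝ) 1} ∧ Set.EqOn r.integrand (fun x => Polynomial.eval (∏ i,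 x i) Q + Polynomial.eval (∏ i, x i) R / (1 - (∏ i, x i) ^ N)) r.domain) → (∃ (Q R : Polynomial ℝ), (∀ i, IsAlgebraic ℚ (Q.coeff i)) ∧ (∀ i, IsAlgebraic ℚ (R.coeff i)) ∧ R.natDegree < N' ∧ (∀ i j : ℕ, i + j + 2 = N' → R.coeff i = (-1 : ℝ) ^ w' * R.coeff j) ∧ (Odd w' → R.coeff (N' - 1) = 0) ∧ r'.domain = {x | ∀ i, x i ∈ Set.Ioo (0:ℝ) 1} ∧ Set.EqOn r'.integrand (fun x => Polynomial.eval (∏ i, x i) Q + Polynomial.eval (∏ i, x i) R / (1 - (∏ i, x i) ^ N')) r'.domain) → r.value = r'.value → KZ.Equivalent r r') → ∀ (k k' N a N' a' : ℕ) (α α' : ℝ), 0 < N → 2 * a ≤ N → 0 < N' → 2 * a' ≤ N' → IsAlgebraic ℚ α → IsAlgebraic ℚ α' → 0 < α → 0 < α' → ∀ (r : KZ.IntegralRep (k + 3)) (r' : KZ.IntegralRep (k' + 3)), r.domain = {z | (∀ i : Fin (k + 2), z (Fin.castSucc i) ∈ Set.Ioo (0:ℝ) 1) ∧ z (Fin.last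 (k + 2)) ∈ Set.Ioo 0 α} → Set.EqOn r.integrand (fun z => if Even k then (Real.cos (2 * Real.pi * a / N) - ∏ i : Fin (k + 2), z (Fin.castSucc i)) / (1 - 2 * Real.cos (2 * Real.pi * a / N) * (∏ i : Fin (k + 2), z (Fin.castSucc i)) + (∏ i : Fin (k + 2), z (Fin.castSucc i)) ^ 2) else Real.sqrt (1 - Real.cos (2 * Real.pi * a / N) ^ 2) / (1 - 2 * Real.cos (2 * Real.pi * a / N) * (∏ i : Fin (k + 2), z (Fin.castSucc i)) + (∏ i : Fin (k + 2), z (Fin.castSucc i)) ^ 2)) r.domain → r'.domain = {z | (∀ i : Fin (k' + 2), z (Fin.castSucc i) ∈ Set.Ioo (0:ℝ) 1) ∧ z (Fin.last (k' + 2)) ∈ Set.Ioo 0 α'} → Set.EqOn r'.integrand (fun z => if Even k' then (Real.cos (2 * Real.pi * a' / N') - ∏ i : Fin (k' + 2), z (Fin.castSucc i)) / (1 - 2 * Real.cos (2 * Real.pi * a' / N') * (∏ i : Fin (k' + 2), z (Fin.castSucc i)) + (∏ i : Fin (k' + 2), z (Fin.castSucc i)) ^ 2) else Real.sqrt (1 -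 Real.cos (2 * Real.pi * a' / N') ^ 2) / (1 - 2 * Real.cos (2 * Real.pi * a' / N') * (∏ i : Fin (k' + 2), z (Fin.castSucc i)) + (∏ i : Fin (k' + 2), z (Fin.castSucc i)) ^ 2)) r'.domain → r.value = r'.value → KZ.Equivalent r r' := by
  intro hPTS k k' N a N' a' α α' hN ha hN' ha' hα hα' hα0 hα0' r r' hrd hrf hr'd hr'f hv
  obtain ⟨r₀, hshape, hrr₀⟩ := detwist k N a α hN ha hα hα0 r hrd hrf
  obtain ⟨r₀', hshape', hrr₀'⟩ := detwist k' N' a' α' hN' ha' hα' hα0' r' hr'd hr'f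
  have hv₀ : r₀.value = r₀'.value := by
    rw [← KZ.Equivalent.value_eq_holds hrr₀, ← KZ.Equivalent.value_eq_holds hrr₀', hv]
  have h := hPTS (k + 2) N (k' + 2) N' (by omega) hN (by omega) hN' r₀ r₀' hshape hshape' hv₀
  exact (hrr₀.trans h).trans hrr₀'.symm

end Summit.KontsevichZagierPeriods.Theorems.HurwitzMicroSectorsHurwitzSectorComplement

end
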